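import Literature.Computability.ImplicitComplexity.STAEncMultiBeta
import Literature.Computability.ImplicitComplexity.STAEncZone
import HarnessLib

/-!
# GMR08 completeness infrastructure, IV: `n`-ary tensors (tuples and `let`)

Support file 4 for the completeness half of
`Literature.Computability.ImplicitComplexity.STACapturesP` (GMR08 Thm. 3.9): the `n`-ary
tensor product "defined through the binary one … modulo associativity" (GMR PSPACE paper §5,
GMR08 §3.2) is taken here directly in its Church form

* `tyTensN [A₁,…,Aₙ] ≐ ∀β.(A₁ ⊸ ⋯ ⊸ Aₙ ⊸ β) ⊸ β`, `Term.tuple [M₁,…,Mₙ] ≐ λx. x M₁ ⋯ Mₙ`,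
  `Term.letT n p R ≐ p (λx₁…xₙ.R)` ("`let p be x₁,…,xₙ in R`");
* `reduces_letT_tuple`: `let ⟨M₁,…,Mₙ⟩ be x⃗ in R →β* R[M⃗/x⃗]`;
* the typings `HTz.tuple` (components own disjoint local slots, the input string is shared) and
  `HTz.letT`, on top of the zone toolkit of `STAEncZone`;
* commutation of renaming / substitution with `tuple`, `letT`, `lams`, spines, and the
  congruence of `→β*` in tuple components and spine arguments.

## References

* [GaboardiMarionRonchidellarocca2008] GMR08 §3.2; M. Gaboardi, J.-Y. Marion, S. Ronchi Della
  Rocca, *An Implicit Characterization of PSPACE*, ACM TOCL 13 (2012), §5 "Some syntactic sugar".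
-/

namespace Literature.Computability.ImplicitComplexity

namespace STA

/-! ### Heterogeneous binder lists -/

/-- The context under the binders `λx₁:σ₁ … λxₙ:σₙ` (outermost first) over `Γ`: slot `0` is
`xₙ`, slot `n - 1` is `x₁`. [folklore] -/
def Ctx.pushL : List SoftTy → Ctx → Ctx
  | [], Γ => Γ
  | σ :: σs, Γ => Ctx.pushL σs (Ctx.cons (some σ) Γ)

/-- `pushL_nil` (bookkeeping). [folklore] -/
@[simp] theorem Ctx.pushL_nil (Γ : Ctx) : Ctx.pushL [] Γ = Γ := rfl
/-- `pushL_cons` (bookkeeping). [folklore] -/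
@[simp] theorem Ctx.pushL_cons (σ : SoftTy) (σs : List SoftTy) (Γ : Ctx) :
    Ctx.pushL (σ :: σs) Γ = Ctx.pushL σs (Ctx.cons (some σ) Γ) := rfl

/-- Slots of `pushL`: below `n` the binders (innermost = slot `0` = last of the list), above `n`
the old context. [folklore] -/
theorem Ctx.pushL_apply (σs : List SoftTy) (Γ : Ctx) (i : ℕ) :
    Ctx.pushL σs Γ i = if h : i < σs.length then some (σs.get ⟨σs.length - 1 - i, by omega⟩) else Γ (i - σs.length) := by
  induction σs generalizing Γ i with
  | nil => simp
  | cons σ σs ih =>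
    rw [Ctx.pushL_cons, ih]
    by_cases h : i < σs.length
    · simp only [h, dif_pos, List.length_cons, show i < σs.length + 1 by omega]
      congr 1
      have e : σs.length + 1 - 1 - i = (σs.length - 1 - i) + 1 := by omega
      simp only [List.get_eq_getElem, e, List.getElem_cons_succ]
    · by_cases h' : i = σs.length
      · subst h'
        simp [Ctx.cons]
      · simp only [h, dif_neg, not_false_eq_true, List.length_cons, show ¬(i < σs.length + 1) by omega]
        have e : i - σs.length = (i - (σs.length + 1)) + 1 := by omega
        rw [e]; rfl

/-- `n` heterogeneous abstractions. [cite: GaboardiMarionRonchidellarocca2008, Table 2 (⊸I)] -/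
theorem HT.lamsL {r : ℕ} {Γ : Ctx} {M : Term} {A : LinTy} (σs : List SoftTy)
    (h : HT r (Ctx.pushL σs Γ) M ⟨0, A⟩) : HT r Γ (Term.lams σs.length M) ⟨0, LinTy.arrows σs A⟩ := by
  induction σs generalizing Γ with
  | nil => exact h
  | cons σ σs ih => exact (ih h).lam

/-- `n` heterogeneous abstractions at depth `k` (the string moves to `k + n`).
[cite: GaboardiMarionRonchidellarocca2008, Table 2 (⊸I)] -/
theorem HTz.lamsL {r m k : ℕ} {L : Ctx} {M : Term} {A : LinTy} (σs : List SoftTy)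
    (h : HTz r m (k + σs.length) (Ctx.pushL σs L) M ⟨0, A⟩) : HTz r m k L (Term.lams σs.length M) ⟨0, LinTy.arrows σs A⟩ := by
  induction σs generalizing k L with
  | nil => exact h
  | cons σ σs ih =>
    refine HTz.lam (ih ?_)
    simpa [Nat.add_assoc, Nat.add_comm 1] using h

/-! ### Type substitution helpers -/

/-- Shifting the free type variables of a derivation. [folklore] -/
theorem HT.shiftT {r : ℕ} {Γ : Ctx} {M : Term} {σ : SoftTy} (h : HT r Γ M σ) : HT r Γ.shift M σ.shift := by
  obtain ⟨d, w, h⟩ := h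
  exact ⟨d, w, h.shiftT⟩

/-- Shifting the free type variables of a zone derivation (the string type is closed). [folklore] -/
theorem HTz.shiftT {r m k : ℕ} {L : Ctx} {M : Term} {σ : SoftTy} (h : HTz r m k L M σ) : HTz r m k L.shift M σ.shift := by
  obtain ⟨lv, h⟩ := h
  have h1 := h.shiftT
  rw [Ctx.zone_shift] at h1
  exact ⟨lv, h1⟩

/-- Substituting in iterated linear arrows over a mapped list. [folklore] -/
theorem LinTy.arrows_map_substp {ι : Type} (l : List ι) (f : ι → SoftTy) (A : LinTy) (θ : ℕ → LinTy) :
    (LinTy.arrows (l.map f) A).substp θ = LinTy.arrows (l.map fun x => (f x).substT θ) (A.substp θ) := by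
  induction l with
  | nil => rfl
  | cons x l ih => simp [LinTy.arrows, LinTy.substp, ih, SoftTy.substT]

/-! ### Tuples, `let`, `n`-ary tensor types -/

/-- `⟨M₁,…,Mₙ⟩ ≐ λx. x M₁ ⋯ Mₙ`. [cite: GaboardiMarionRonchidellarocca2008, §3.2] -/
def Term.tuple (Ms : List Term) : Term := .lam ((Term.var 0).apps (Ms.map fun M => M.rename Nat.succ))

/-- `let p be x₁,…,xₙ in R ≐ p (λx₁…xₙ.R)`. [cite: GaboardiMarionRonchidellarocca2008, §3.2] -/
def Term.letT (n : ℕ) (p R : Term) : Term := .app p (Term.lams n R)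

/-- `A₁ ⊗ ⋯ ⊗ Aₙ ≐ ∀β.(A₁ ⊸ ⋯ ⊸ Aₙ ⊸ β) ⊸ β` (linear components). [cite: GaboardiMarionRonchidellarocca2008, §3.2] -/
def tyTensN (As : List LinTy) : LinTy :=
  .all (.limp 0 (LinTy.arrows (As.map fun A => ⟨0, A.rename Nat.succ⟩) (.tvar 0)) (.tvar 0))

/-- Sum-freeness of tuples. [folklore] -/
theorem Term.SumFree.tuple {Ms : List Term} (h : ∀ M ∈ Ms, M.SumFree) : (Term.tuple Ms).SumFree := by
  refine Term.SumFree.apps (M := .var 0) trivial fun N hN => ?_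
  obtain ⟨M, hM, rfl⟩ := List.mem_map.1 hN
  exact (h M hM).rename _

/-- Sum-freeness of `let`. [folklore] -/
theorem Term.SumFree.letT {n : ℕ} {p R : Term} (hp : p.SumFree) (hR : R.SumFree) : (Term.letT n p R).SumFree :=
  ⟨hp, hR.lams n⟩

/-- Renaming a tuple. [folklore] -/
theorem Term.tuple_rename (Ms : List Term) (ρ : ℕ → ℕ) :
    (Term.tuple Ms).rename ρ = Term.tuple (Ms.map fun M => M.rename ρ) := by
  simp only [Term.tuple, Term.rename, Term.rename_apps, List.map_map, liftRen]
  congr 2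
  refine List.map_congr_left fun M _ => ?_
  simp only [Function.comp_apply, Term.rename_rename, liftRen_comp_succ]

/-- Substituting in a tuple. [folklore] -/
theorem Term.tuple_substp (Ms : List Term) (τ : ℕ → Term) :
    (Term.tuple Ms).substp τ = Term.tuple (Ms.map fun M => M.substp τ) := by
  simp only [Term.tuple, Term.substp, Term.substp_apps, List.map_map, Term.up]
  congr 2
  refine List.map_congr_left fun M _ => ?_
  simp only [Function.comp_apply, Term.substp_rename, Term.rename_substp]
  rfl

/-- Renaming a `let`. [folklore] -/
theorem Term.letT_rename (n : ℕ) (p R : Term) (ρ : ℕ → ℕ) :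
    (Term.letT n p R).rename ρ = Term.letT n (p.rename ρ) (R.rename (liftRen^[n] ρ)) := by
  simp [Term.letT, Term.rename, Term.rename_lams]

/-- Substituting in a `let`. [folklore] -/
theorem Term.letT_substp (n : ℕ) (p R : Term) (τ : ℕ → Term) :
    (Term.letT n p R).substp τ = Term.letT n (p.substp τ) (R.substp (Term.up^[n] τ)) := by
  simp [Term.letT, Term.substp, Term.substp_lams]

/-- `subst0` in a spine. [folklore] -/
theorem Term.subst0_apps (M : Term) (Ns : List Term) (N : Term) :
    (M.apps Ns).subst0 N = (M.subst0 N).apps (Ns.map fun P => P.subst0 N) := by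
  simp only [Term.subst0_eq_substp, Term.substp_apps]

/-- **`let ⟨M₁,…,Mₙ⟩ be x₁,…,xₙ in R →β* R[M⃗/x⃗]`.** [cite: GaboardiMarionRonchidellarocca2008, §3.2] -/
theorem reduces_letT_tuple {n : ℕ} (Ms : List Term) (R : Term) (hlen : Ms.length = n) :
    Reduces (Term.letT n (Term.tuple Ms) R) (R.substp (Term.subL Ms)) := by
  unfold Term.letT Term.tuple
  have hβ : Red (Term.app (.lam ((Term.var 0).apps (Ms.map fun M => M.rename Nat.succ))) (Term.lams n R))
      ((Term.lams n R).apps Ms) := by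
    have := Red.beta ((Term.var 0).apps (Ms.map fun M => M.rename Nat.succ)) (Term.lams n R)
    rw [Term.subst0_apps, Term.subst0_var_zero, List.map_map] at this
    have e : (Ms.map ((fun P => P.subst0 (Term.lams n R)) ∘ fun M => M.rename Nat.succ)) = Ms := by
      conv_rhs => rw [← List.map_id Ms]
      refine List.map_congr_left fun M _ => ?_
      simp [Term.subst0_rename_succ]
    rwa [e] at this
  exact (Relation.ReflTransGen.single hβ).trans (reduces_apps_lams n R Ms hlen)

/-- `→β*` in the arguments of a spine. [folklore] -/
theorem Reduces.apps_args (M : Term) {Ns Ns' : List Term} (h : List.Forall₂ Reduces Ns Ns') :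
    Reduces (M.apps Ns) (M.apps Ns') := by
  induction h generalizing M with
  | nil => exact Relation.ReflTransGen.refl
  | @cons N N' Ns Ns' hN _ ih => exact (Reduces.apps (Reduces.appR M hN) Ns).trans (ih _)

/-- `→β*` in the components of a tuple. [folklore] -/
theorem Reduces.tuple {Ms Ms' : List Term} (h : List.Forall₂ Reduces Ms Ms') :
    Reduces (Term.tuple Ms) (Term.tuple Ms') := by
  refine Reduces.lam (Reduces.apps_args _ ?_)
  induction h with
  | nil => exact List.Forall₂.nil
  | cons hN _ ih => exact List.Forall₂.cons (hN.rename _) ih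

/-- `→β*` in both parts of a `let`. [folklore] -/
theorem Reduces.letT (n : ℕ) {p p' R R' : Term} (hp : Reduces p p') (hR : Reduces R R') :
    Reduces (Term.letT n p R) (Term.letT n p' R') :=
  Reduces.app hp (hR.lams n)

/-! ### Typing tuples and `let` -/

/-- The `n`-ary tensor type instantiated at `C`. [folklore] -/
theorem tyTensN_inst (As : List LinTy) (C : LinTy) :
    (LinTy.limp 0 (LinTy.arrows (As.map fun A => ⟨0, A.rename Nat.succ⟩) (.tvar 0)) (.tvar 0)).inst C =
      .limp 0 (LinTy.arrows (As.map fun A => (⟨0, A⟩ : SoftTy)) C) C := by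
  rw [LinTy.inst_eq_substp]
  simp only [LinTy.substp, LinTy.arrows_map_substp, SoftTy.substT]
  congr 2
  · refine List.map_congr_left fun A _ => ?_
    congr 1
    rw [← LinTy.inst_eq_substp]
    exact LinTy.inst_rename_succ _ _

/-- The context of the spine `x M₁ ⋯ Mⱼ` inside a tuple: slot `0` is `x`, a shifted local slot
`i + 1` is present iff component `owner i < j` has been applied. [folklore] -/
def tupleCtx (L : Ctx) (owner : ℕ → ℕ) (j : ℕ) (hd : Option SoftTy) : Ctx :=
  Ctx.cons hd fun i => if owner i < j then L i else none

/-- **Typing a tuple** at depth `k`: if component `j` is typed with the local slots it owns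
(`owner i = j`) and all components share the string, then `⟨M₀,…,Mₙ₋₁⟩ : A₀ ⊗ ⋯ ⊗ Aₙ₋₁`.
[cite: GaboardiMarionRonchidellarocca2008, §3.2] -/
theorem HTz.tuple {r m k : ℕ} (hr : 2 ≤ r) {L : Ctx} (owner : ℕ → ℕ) (Ms : List Term) (As : List LinTy)
    (hlen : Ms.length = As.length)
    (h : ∀ j (hj : j < Ms.length), HTz r m k (fun i => if owner i = j then L i else none) (Ms.get ⟨j, hj⟩)
      ⟨0, As.get ⟨j, hlen ▸ hj⟩⟩) :
    HTz r m k L (Term.tuple Ms) ⟨0, tyTensN As⟩ := by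
  refine HTz.allI (HTz.lam (τ := ⟨0, LinTy.arrows (As.map fun A => ⟨0, A.rename Nat.succ⟩) (.tvar 0)⟩) ?_)
  -- the spine, by induction on a prefix of the components
  have key : ∀ j (hj : j ≤ Ms.length),
      HTz r m (k + 1) (tupleCtx L.shift owner j (some ⟨0, LinTy.arrows (As.map fun A => ⟨0, A.rename Nat.succ⟩) (.tvar 0)⟩))
        ((Term.var 0).apps ((Ms.take j).map fun M => M.rename Nat.succ))
        ⟨0, LinTy.arrows ((As.drop j).map fun A => ⟨0, A.rename Nat.succ⟩) (.tvar 0)⟩ := by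
    intro j hj
    induction j with
    | zero =>
      simp only [List.take_zero, List.map_nil, Term.apps_nil, List.drop_zero]
      exact HTz.lvar (by omega) (by simp [tupleCtx, Ctx.cons])
    | succ j ih =>
      have hj' : j < Ms.length := by omega
      have ih := ih (by omega)
      rw [List.drop_eq_getElem_cons (by simpa [hlen] using hj')] at ih
      simp only [List.map_cons, LinTy.arrows] at ih
      rw [List.take_add_one, List.getElem?_eq_getElem hj', Option.toList_some, List.map_append, List.map_singleton,
        Term.apps_append, Term.apps_cons, Term.apps_nil]
      -- the component `j`, shifted in types and carried under the binder `x`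
      have hc := ((h j hj').shiftT).shift_succ none
      simp only [List.get_eq_getElem, SoftTy.shift] at hc
      refine HTz.app hr (L₁ := tupleCtx L.shift owner j (some ⟨0, LinTy.arrows (As.map fun A => ⟨0, A.rename Nat.succ⟩) (.tvar 0)⟩))
        (L₂ := Ctx.cons none (fun i => if owner i = j then L.shift i else none)) (fun i => ?_) ih ?_
      · cases i with
        | zero => exact Or.inl ⟨rfl, rfl⟩
        | succ i =>
          simp only [tupleCtx, Ctx.cons]
          by_cases h1 : owner i < j
          · left; simp [h1, show owner i < j + 1 by omega, show owner i ≠ j by omega]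
          · by_cases h2 : owner i = j
            · right; simp [h2]
            · left; simp [h1, h2, show ¬(owner i < j + 1) by omega]
      · refine hc.congrL fun i _ => ?_
        cases i with
        | zero => rfl
        | succ i => simp only [Ctx.cons, Ctx.shift]; by_cases h2 : owner i = j <;> simp [h2]
  have := key Ms.length le_rfl
  rw [List.take_length, List.drop_eq_nil_of_le (by omega)] at this
  simp only [List.map_nil, LinTy.arrows] at this
  refine this.weakenL fun i _ hne => ?_
  cases i with
  | zero => rfl
  | succ i =>
    simp only [tupleCtx, Ctx.cons] at hne ⊢
    by_cases h1 : owner i < Ms.length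
    · simp [h1]
    · simp [h1] at hne

/-- **Typing `let`** at depth `k`: `p : A₁ ⊗ ⋯ ⊗ Aₙ` with locals `L₁`, the body `R : C` under the
binders `x₁:A₁,…,xₙ:Aₙ` with locals `L₂`, `L = L₁ ⊎ L₂`, string shared.
[cite: GaboardiMarionRonchidellarocca2008, §3.2] -/
theorem HTz.letT {r m k : ℕ} (hr : 2 ≤ r) {L L₁ L₂ : Ctx} (hs : L.Split L₁ L₂) {p R : Term}
    {As : List LinTy} {C : LinTy} (hp : HTz r m k L₁ p ⟨0, tyTensN As⟩)
    (hR : HTz r m (k + As.length) (Ctx.pushL (As.map fun A => (⟨0, A⟩ : SoftTy)) L₂) R ⟨0, C⟩) :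
    HTz r m k L (Term.letT As.length p R) ⟨0, C⟩ := by
  have hp' := hp.allE C
  rw [tyTensN_inst] at hp'
  have hR' := HTz.lamsL (As.map fun A => (⟨0, A⟩ : SoftTy)) (by simpa using hR)
  rw [List.length_map] at hR'
  exact HTz.app hr hs hp' hR'

end STA

end Literature.Computability.ImplicitComplexity
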